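import Summits.CriticalPhenomena.PercolationContinuityZ3.Theorems.Transplant.SiteKNLevels
import Summits.CriticalPhenomena.PercolationContinuityZ3.Theorems.Transplant.SiteKNUniqZone
import Literature.Probability.Percolation.SitePaths
import Literature.Probability.Percolation.KozmaNitzanPinning
import HarnessLib

/-!
# SITE Kozma–Nitzan §4, Lemma 10 — part 4: Step IV, behind every contact there is a vertex of `A_ξ`
# (site twin of `L/KozmaNitzanTargetLemma.lean` ll. 351–535)

builds on p205010 (kernel theorem, internal audit signed; external expert review pending).
Lane `prim-bschramm`, class C1a (site percolation on `ℤ³`), seat p1 gen 3, block (α) of the SITE same-`p` witness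
(`SiteSameP.SiteSamePWitnessZd`, socket p217536).  Helper file (`--supports stmt-CriticalPhenomena-4575`).

SITE form of KN pp. 19–21, (21) ⟹ (24) ⟹ (25): conditioning on the STATES OF THE VERTICES of the shell `S` (vertex
pinning `pinW w ↑S ξ`), a vertex `u` of the face `U` behind a contact is GOOD for the pattern `ξ` if
`P(u ↔^{site} T inside Rg | ξ) > 1 − δ` (such a `u` is necessarily open in `ξ`).

* **`stepIV_in`** — let `Q = v + Λ_M ⊆ S`, `U ⊆ ∂^{in} Q`; if with probability `> 1 − δ²` each the site uniqueness zone
  `siteUniqZoneAt v m M` holds, `v + Λ_m` is joined to `U` inside `Q`, and `v + Λ_m` is joined inside `Qt` to a set `Ft ⊆ T`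
  disjoint from `Q`, then for every region `Rg ⊇ Q ∪ Qt`, with probability `≥ 1 − 3δ` some `u ∈ U` is good
  (Markov-type bound `prodBernoulli_real_pinLow_le'` on the patterns of `S`; inside a good cylinder the arm to `U`, frozen
  by the pinning, is glued by the uniqueness zone to the exit point of the target route).
No `IsSubbox` / lattice-only hypothesis is needed in the site form (every open-site path is a lattice path).
[cite: KozmaNitzan2024, §4 pp. 19–21 (Step IV, (21)–(25))]
-/

noncomputable section

namespace Summit.CriticalPhenomena.PercolationContinuityZ3.Theorems.Transplant

namespace SiteKN

open MeasureTheory ProbabilityTheory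
open Literature.Probability.Percolation Literature.Probability.LatticeModels
open Literature.Probability.Percolation.KozmaNitzan (mem_ball_iff_sub)

variable {d : ℕ}

/-- `siteConnIn` is symmetric (membership form). [folklore] -/
theorem siteConnIn_symm {S : Set (Site d)} {x y : Site d} {ω : SiteConfig (Site d)}
    (h : ω ∈ siteConnIn (zdGraph d) S x y) : ω ∈ siteConnIn (zdGraph d) S y x := by
  rw [siteConnIn_comm]; exact h

/-- **Step IV with region-internal reliability** (site form of KN pp. 19–21, (21) ⟹ (24) ⟹ (25)).
[cite: KozmaNitzan2024, §4 pp. 19–21 (Step IV, (21)–(25)); p. 16 (definition of a target)] -/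
theorem stepIV_in {w : Site d → unitInterval} {S T U Qt Ft : Finset (Site d)}
    (hT : Ft ⊆ T) {v : Site d} {m M : ℕ} (hmM : m ≤ M)
    (hQS : GM.ball v M ⊆ S) (hU : U ⊆ innerBoundary (zdGraph d) (GM.ball v M))
    (hfar : Disjoint Ft (GM.ball v M)) {δ : ℝ} (hδ : 0 < δ) {Rg : Set (Site d)}
    (hRb : (↑(GM.ball v M) : Set (Site d)) ⊆ Rg) (hRQ : (↑Qt : Set (Site d)) ⊆ Rg)
    (h1 : 1 - δ ^ 2 < (prodBernoulli w).real (siteUniqZoneAt v m M))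
    (h2 : 1 - δ ^ 2 < (prodBernoulli w).real (siteLinkIn (↑(GM.ball v M)) (GM.ball v m) U))
    (h3 : 1 - δ ^ 2 < (prodBernoulli w).real (siteLinkIn (↑Qt) (GM.ball v m) Ft)) :
    1 - 3 * δ ≤ (prodBernoulli w).real {ω | ∃ u ∈ U,
      1 - δ < (prodBernoulli (pinW w (↑S : Set (Site d)) ω)).real
        (⋃ t ∈ T, siteConnIn (zdGraph d) Rg u t)} := by
  classical
  rcases le_or_gt δ 1 with hδ1 | hδ1
  swap
  · exact le_trans (by linarith) measureReal_nonneg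
  have hballmono : GM.ball v m ⊆ GM.ball v M := fun z hz => by
    rw [mem_ball_iff_sub] at hz ⊢; exact box_mono d hmM hz
  set μ := prodBernoulli w with hμ
  set G : Set (SiteConfig (Site d)) := siteUniqZoneAt v m M ∩ siteLinkIn (↑(GM.ball v M)) (GM.ball v m) U ∩
    siteLinkIn (↑Qt) (GM.ball v m) Ft with hG
  have hGm : MeasurableSet G :=
    ((measurableSet_siteUniqZoneAt v m M).inter (measurableSet_siteLinkIn _ _ _)).inter (measurableSet_siteLinkIn _ _ _)
  -- `μ G > 1 - 3 δ²`
  have hGprob : 1 - 3 * δ ^ 2 < μ.real G := by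
    have hcov : Gᶜ ⊆ (siteUniqZoneAt v m M)ᶜ ∪ (siteLinkIn (↑(GM.ball v M)) (GM.ball v m) U)ᶜ ∪
        (siteLinkIn (↑Qt) (GM.ball v m) Ft)ᶜ := by
      intro ω hω
      simp only [hG, Set.mem_compl_iff, Set.mem_inter_iff, not_and, Set.mem_union] at hω ⊢
      tauto
    have hb := (measureReal_mono hcov (μ := μ)).trans ((measureReal_union_le _ _).trans
      (add_le_add (measureReal_union_le _ _) le_rfl))
    rw [measureReal_compl (measurableSet_siteUniqZoneAt v m M), measureReal_compl (measurableSet_siteLinkIn _ _ _),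
      measureReal_compl (measurableSet_siteLinkIn _ _ _), probReal_univ, measureReal_compl hGm, probReal_univ] at hb
    linarith
  -- Markov: the low-conditional-probability patterns have mass `< 3δ`
  have hMarkov := prodBernoulli_real_pinLow_le' w S hGm δ
  have hLlt : μ.real (pinLow w ↑S G δ) < 3 * δ := by
    by_contra hge
    push Not at hge
    have : δ * (3 * δ) ≤ δ * μ.real (pinLow w ↑S G δ) := mul_le_mul_of_nonneg_left hge hδ.le
    nlinarith
  -- outside it, some `u ∈ U` is good
  have hincl : (pinLow w ↑S G δ)ᶜ ⊆ {ω | ∃ u ∈ U,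
      1 - δ < (prodBernoulli (pinW w (↑S : Set (Site d)) ω)).real (⋃ t ∈ T, siteConnIn (zdGraph d) Rg u t)} := by
    intro ω hω
    simp only [Set.mem_compl_iff, mem_pinLow_iff, not_le] at hω
    have hpos : 0 < (prodBernoulli (pinW w ↑S ω)).real (G ∩ localCylinder ↑S ω) := by
      rw [prodBernoulli_pinW_real_inter_localCylinder w (S.finite_toSet.countable) ω G]
      exact lt_of_le_of_lt (sub_nonneg.2 hδ1) hω
    obtain ⟨ω₁, hω₁G, hω₁c⟩ := nonempty_of_measureReal_ne_zero (ne_of_gt hpos)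
    obtain ⟨⟨hUZ₁, hlinkU₁⟩, -⟩ := hω₁G
    obtain ⟨x₀, hx₀, u₀, hu₀, harm₁⟩ := hlinkU₁
    have cyl_eq : ∀ ω' ∈ localCylinder (↑S : Set (Site d)) ω,
        ω₁ ∩ (↑(GM.ball v M) : Set (Site d)) = ω' ∩ ↑(GM.ball v M) := by
      intro ω' hω'
      ext z
      simp only [Set.mem_inter_iff, Finset.mem_coe]
      constructor
      · rintro ⟨hz, hzb⟩
        exact ⟨(hω' z (Finset.mem_coe.2 (hQS hzb))).2 ((hω₁c z (Finset.mem_coe.2 (hQS hzb))).1 hz), hzb⟩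
      · rintro ⟨hz, hzb⟩
        exact ⟨(hω₁c z (Finset.mem_coe.2 (hQS hzb))).2 ((hω' z (Finset.mem_coe.2 (hQS hzb))).1 hz), hzb⟩
    refine ⟨u₀, hu₀, ?_⟩
    have key : G ∩ localCylinder ↑S ω ⊆ ⋃ t ∈ T, siteConnIn (zdGraph d) Rg u₀ t := by
      rintro ω' ⟨⟨⟨hUZ', -⟩, hlinkT'⟩, hω'c⟩
      have hc := cyl_eq ω' hω'c
      -- the arm from `x₀` to `u₀` inside the ball, in `ω'`
      have harm' : ω' ∈ siteConnIn (zdGraph d) (↑(GM.ball v M)) x₀ u₀ :=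
        ((determinedBy_iff _ _).1 (determinedBy_siteConnIn (zdGraph d) _ x₀ u₀) ω₁ ω' hc).1 harm₁
      -- the route to `Ft`, exiting the ball
      obtain ⟨x', hx', t', ht', hroute⟩ := hlinkT'
      have ht'ball : t' ∉ (↑(GM.ball v M) : Set (Site d)) := fun h' =>
        Finset.disjoint_left.1 hfar ht' (Finset.mem_coe.1 h')
      have hx'ball : x' ∈ (↑(GM.ball v M) : Set (Site d)) := Finset.mem_coe.2 (hballmono hx')
      have hpath : PathIn (zdGraph d) ((↑Qt : Set (Site d)) ∩ ω') x' t' := mem_siteConnIn_iff_pathIn.1 hroute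
      obtain ⟨a, b, ha, hb, _, hab, hpa⟩ := hpath.exit hx'ball ht'ball
      have habdry : a ∈ innerBoundary (zdGraph d) (GM.ball v M) := by
        rw [mem_innerBoundary_iff]
        exact ⟨Finset.mem_coe.1 ha, b, fun h' => hb (Finset.mem_coe.2 h'), hab⟩
      have hx'a : ω' ∈ siteConnIn (zdGraph d) (↑(GM.ball v M)) x' a := by
        refine mem_siteConnIn_iff_pathIn.2 (hpa.mono ?_)
        intro z hz; exact ⟨hz.1, hz.2.2⟩
      have hx'bd : ω' ∈ siteToBdryAt v M x' := mem_siteToBdryAt_iff.2 ⟨a, habdry, hx'a⟩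
      have hx₀bd : ω' ∈ siteToBdryAt v M x₀ := mem_siteToBdryAt_iff.2 ⟨u₀, hU hu₀, harm'⟩
      have hconn : ω' ∈ siteConnIn (zdGraph d) (↑(GM.ball v M)) x₀ x' := hUZ' x₀ hx₀ x' hx' hx₀bd hx'bd
      simp only [Set.mem_iUnion, exists_prop]
      refine ⟨t', hT ht', ?_⟩
      have s1 : ω' ∈ siteConnIn (zdGraph d) Rg u₀ x' :=
        siteConnIn_trans (zdGraph d) hRb hRb (siteConnIn_symm harm') hconn
      exact siteConnIn_trans (zdGraph d) le_rfl hRQ s1 hroute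
    have hge := measureReal_mono (μ := prodBernoulli (pinW w ↑S ω)) key (measure_ne_top _ _)
    rw [prodBernoulli_pinW_real_inter_localCylinder w (S.finite_toSet.countable) ω G] at hge
    exact hω.trans_le hge
  have hLm : MeasurableSet (pinLow w (↑S : Set (Site d)) G δ) :=
    (determinedBy_pinLow w (↑S) G δ).measurableSet_of_finset
  calc 1 - 3 * δ ≤ μ.real (pinLow w ↑S G δ)ᶜ := by
        rw [measureReal_compl hLm, probReal_univ]; linarith
    _ ≤ μ.real {ω | ∃ u ∈ U,
          1 - δ < (prodBernoulli (pinW w (↑S : Set (Site d)) ω)).real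
            (⋃ t ∈ T, siteConnIn (zdGraph d) Rg u t)} := measureReal_mono hincl

end SiteKN

end Summit.CriticalPhenomena.PercolationContinuityZ3.Theorems.Transplant

end
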